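import Summits.NavierStokesRegularity.FluidComputer.PalasekTowerRegister

/-!
# Non-vacuity of the registered SCHEDULE class (REGISTER v2.1): the window schedule

Cell `ns-blowup`; typist `ns-blowup-lean` (g2); companion of `PalasekTowerRegister.lean` (planner
`ns-blowup-plan` g16, REGISTER v2.1, STATUS l.1039). LABEL: E–C typing / BC7 bookkeeping (KERNEL).
WHAT THIS IS NOT: not Navier–Stokes evidence — a schedule with ZERO datum and ZERO force showing that
the schedule-level clauses of the register (`Schedule.Pins 8 (6/5)` and `Schedule.Rigid`: window
equality, `c₅ = 4bβ`, `c₁ = 1`, `c₂ = 5/3`) are jointly satisfiable on `TowerRates.wide`. It carries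
no stage and says nothing about dynamics. Consequence for the route: K1R (`EpisodeBaseR`) is not
false for time-arithmetic reasons; its content is the STAGE.

* §1 (generic) `Schedule.ofWindows R c₃ r …`: readouts `τ₀ = 1`, `τ_{k+1} = τ_k + w_k`,
  `w_k := 4bβ log N_{k+1} / A_k`, blow-up time `T := 1 + Σ_k w_k`; given a geometric domination
  `w_{k+1} ≤ r w_k` (`0 ≤ r < 1`) and the clock arithmetic `A_k w_{k+1} ≤ (1 − r) c₃`, every
  `Schedule` field holds with `c₃` as the clock witness (`T − τ_{k+1} = Σ_{j>k} w_j ≤ w_{k+1}/(1−r)`),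
  and the schedule satisfies `Schedule.Pins Λ (6/5)` (any `Λ`; force `c₄ = 0`) and `Schedule.Rigid`
  whenever the rates afford `2 Y_k ≤ Y_{k+1}`.
* §2 (the registered instance) on `TowerRates.wide`: `w_{k+1} = b N_k^{-β(b-1)} w_k ≤ w_k / 3`
  (`256^{0.23} ≥ 3.3`) and `A_k w_{k+1} = 12.2452 · L · e^{-0.23 L} ≤ (2/3) · 32` for
  `L = log N_k ≥ log 256` (from `e^z ≥ 1 + z + z²/2 + z³/6` and `log 2 > 0.693`), whence
  `TowerRates.exists_registered_schedule : ∃ S : Schedule wide, S.Pins 8 (6/5) ∧ S.Rigid ∧ ∀ t, S.f t = 0`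
  (planner l.1039: "any `c₃ ≥ 26` works on wide"; here `c₃ = 32`; the last conjunct is REGISTER
  v2.2's `Schedule.Quiet` in its strongest form, so the quiet class is nonempty too).

References: S. Palasek, arXiv:2605.13827 §3.3 [cite: Palasek2026ElementaryModel, §3.3].
-/

noncomputable section

namespace Summit.NavierStokesRegularity.FluidComputer.PalasekTowerClayBridge

open Set MeasureTheory Filter Topology Function
open scoped ENNReal ContDiff NNReal
open Literature.Analysis.FluidPDE

/-! ## §0 Rate arithmetic -/

namespace TowerRates

variable (R : TowerRates)

/-- The amplitudes obey `A_{k+1} = A_k · N_k^{β(b-1)}`. [cite: Palasek2026ElementaryModel, §1.2] -/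
theorem A_succ (k : ℕ) : R.A (k + 1) = R.A k * R.N k ^ (R.β * (R.b - 1)) := by
  simp only [TowerRates.A]
  rw [R.N_succ k, ← Real.rpow_mul (R.N_pos k).le, ← Real.rpow_add (R.N_pos k)]
  congr 1
  ring

/-- The velocity scales increase strictly. [folklore] -/
theorem Y_lt_Y_succ (k : ℕ) : R.Y k < R.Y (k + 1) := by
  rw [R.Y_succ k]
  have hY : 0 < R.Y k := Real.rpow_pos_of_pos (R.N_pos k) _
  have h1 : 1 < R.N k ^ ((R.b - 1) * (R.β - 1)) := Real.one_lt_rpow (R.one_lt_N k) R.sepExp_pos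
  nlinarith

/-- The logarithms of the scales obey `log N_{k+1} = b log N_k`. [cite: Palasek2026ElementaryModel, §1.2] -/
theorem log_N_succ (k : ℕ) : Real.log (R.N (k + 1)) = R.b * Real.log (R.N k) := by
  rw [R.N_succ k, Real.log_rpow (R.N_pos k)]

/-- The logarithms of the scales are positive. [folklore] -/
theorem log_N_pos (k : ℕ) : 0 < Real.log (R.N k) := Real.log_pos (R.one_lt_N k)

/-- The growth window of level `k+1` in units of the quiet constant: `w_k = 4bβ log N_{k+1} / A_k`.
[cite: Palasek2026ElementaryModel, §3.3] -/
def window (k : ℕ) : ℝ := 4 * R.b * R.β * Real.log (R.N (k + 1)) / R.A k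

/-- The growth windows are positive. [folklore] -/
theorem window_pos (k : ℕ) : 0 < R.window k := by
  have hb := R.one_lt_b
  have hβ := R.two_lt_β
  have := R.log_N_pos (k + 1)
  have := R.A_pos k
  unfold window
  positivity

end TowerRates

/-! ## §1 The window schedule (generic) -/

namespace Schedule

variable (R : TowerRates)

/-- The readout times of the window schedule: `τ₀ = 1`, `τ_{k+1} = τ_k + w_k`, i.e.
`τ_k = 1 + Σ_{j<k} w_j`. [folklore] -/
def windowTime (k : ℕ) : ℝ := 1 + ∑ j ∈ Finset.range k, R.window j

/-- `τ_{k+1} = τ_k + w_k`. [folklore] -/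
theorem windowTime_succ (k : ℕ) : windowTime R (k + 1) = windowTime R k + R.window k := by
  simp [windowTime, Finset.sum_range_succ, add_assoc]

variable {R}

/-- Geometric domination of the windows makes them summable and bounds every tail:
`Σ_i w_{i+m} ≤ w_m / (1 - r)`. [folklore] -/
theorem window_tail_le {r : ℝ} (hr0 : 0 ≤ r) (hr1 : r < 1)
    (hgeo : ∀ k, R.window (k + 1) ≤ r * R.window k) (m : ℕ) :
    Summable (fun i => R.window (i + m)) ∧
      ∑' i, R.window (i + m) ≤ R.window m / (1 - r) := by
  have hdom : ∀ i, R.window (i + m) ≤ R.window m * r ^ i := by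
    intro i
    induction i with
    | zero => simp
    | succ n ih =>
      have h1 := hgeo (n + m)
      have e : n + 1 + m = n + m + 1 := by ring
      rw [e]
      calc R.window (n + m + 1) ≤ r * R.window (n + m) := h1
        _ ≤ r * (R.window m * r ^ n) := mul_le_mul_of_nonneg_left ih hr0
        _ = R.window m * r ^ (n + 1) := by ring
  have hgs : Summable (fun i : ℕ => R.window m * r ^ i) :=
    (summable_geometric_of_lt_one hr0 hr1).mul_left _
  have hs : Summable (fun i => R.window (i + m)) :=
    Summable.of_nonneg_of_le (fun i => (R.window_pos (i + m)).le) hdom hgs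
  refine ⟨hs, ?_⟩
  calc ∑' i, R.window (i + m) ≤ ∑' i, R.window m * r ^ i := hs.tsum_le_tsum hdom hgs
    _ = R.window m * ∑' i : ℕ, r ^ i := by rw [tsum_mul_left]
    _ = R.window m / (1 - r) := by rw [tsum_geometric_of_lt_one hr0 hr1, div_eq_mul_inv]

/-- **The window schedule** with ZERO datum and ZERO force (REGISTER v2.1 shape): readouts
`τ_k = 1 + Σ_{j<k} w_j`, blow-up time `T = 1 + Σ_k w_k`, constants `c₁ = 1`, `c₂ = 5/3`, `c₃`
(clock witness), `c₄ = 0`, `c₅ = 4bβ`, radius `1`, constant label loops, `Φ ≡ 1`. Hypotheses: the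
windows are geometrically dominated (`w_{k+1} ≤ r w_k`, `0 ≤ r < 1`), the clock witness covers the
tails (`A_k w_{k+1} ≤ (1 − r) c₃`), and the rates afford the registered band (`2 Y₀ ≤ Y₁`). A
bookkeeping object: it carries no stage. [cite: Palasek2026ElementaryModel, §3.3] -/
def ofWindows (R : TowerRates) (c₃ r : ℝ) (hr0 : 0 ≤ r) (hr1 : r < 1) (hgeo : ∀ k, R.window (k + 1) ≤ r * R.window k)
    (hclock : ∀ k, R.A k * R.window (k + 1) ≤ (1 - r) * c₃) (hsep : 2 * R.Y 0 ≤ R.Y 1) :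
    Schedule R where
  T := 1 + ∑' k, R.window k
  τ := windowTime R
  τ_zero_pos := by simp [windowTime]
  τ_lt_succ := fun k => by
    rw [windowTime_succ]
    have := R.window_pos k
    linarith
  τ_lt_T := by
    intro k
    have hs := (window_tail_le hr0 hr1 hgeo 0).1
    simp only [add_zero] at hs
    have hsplit := hs.sum_add_tsum_nat_add k
    have htail := (window_tail_le hr0 hr1 hgeo k).1
    have hpos : 0 < ∑' i, R.window (i + k) := by
      have h1 : R.window (0 + k) ≤ ∑' i, R.window (i + k) :=
        htail.le_tsum 0 (fun j _ => (R.window_pos (j + k)).le)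
      have h2 := R.window_pos (0 + k)
      linarith
    show windowTime R k < 1 + ∑' k, R.window k
    unfold windowTime
    linarith
  c₁ := 1
  c₂ := 5 / 3
  c₃ := c₃
  c₄ := 0
  c₅ := 4 * R.b * R.β
  c₁_pos := one_pos
  c₄_le := by norm_num
  c₅_le := le_rfl
  gap := by
    have hY0 : 0 < R.Y 0 := Real.rpow_pos_of_pos (R.N_pos 0) _
    linarith
  radius := 1
  clock := by
    intro k
    have hs := (window_tail_le hr0 hr1 hgeo 0).1
    simp only [add_zero] at hs
    have hsplit := hs.sum_add_tsum_nat_add (k + 1)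
    obtain ⟨_, htail⟩ := window_tail_le hr0 hr1 hgeo (k + 1)
    have hA : 0 < R.A k := R.A_pos k
    have h1r : 0 < 1 - r := by linarith
    -- `T - τ_{k+1} = Σ_i w_{i+k+1} ≤ w_{k+1}/(1-r) ≤ c₃ / A_k`
    have hwk : R.window (k + 1) / (1 - r) ≤ c₃ / R.A k := by
      rw [div_le_div_iff₀ h1r hA]
      have := hclock k
      nlinarith
    show (1 + ∑' k, R.window k) - windowTime R (k + 1) ≤ c₃ / R.A k
    unfold windowTime
    linarith
  u₀ := 0
  datum_decay := by
    intro n K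
    refine ⟨0, fun x => ?_⟩
    simp
  f := fun _ _ => 0
  force_smooth := by
    show ContDiffOn ℝ ∞ (uncurry fun (_ : ℝ) (_ : EuclideanSpace ℝ (Fin 3)) =>
      (0 : EuclideanSpace ℝ (Fin 3))) _
    exact contDiffOn_const
  force_decay := by
    intro n K
    refine ⟨0, fun t _ x => ?_⟩
    have : (uncurry fun (_ : ℝ) (_ : EuclideanSpace ℝ (Fin 3)) => (0 : EuclideanSpace ℝ (Fin 3))) =
        fun _ => 0 := by
      funext z; rfl
    rw [this, iteratedFDerivWithin_fun_zero]
    simp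
  force_silent := fun _ _ _ => rfl
  push_small := by
    intro k t _ x
    simp
  loop := fun _ _ => 0
  loop_smooth := fun _ => contDiff_const
  loop_closed := fun _ => rfl
  Φ := fun _ => 1
  Φ_pos := fun _ => one_pos

/-- The window schedule's force is identically zero (in particular it is QUIET in the sense of
REGISTER v2.2, `PalasekTowerRegisterQuiet.lean`: `Schedule.Quiet.of_force_eq_zero`). [folklore] -/
theorem ofWindows_force {c₃ r : ℝ} (hr0 : 0 ≤ r) (hr1 : r < 1)
    (hgeo : ∀ k, R.window (k + 1) ≤ r * R.window k)
    (hclock : ∀ k, R.A k * R.window (k + 1) ≤ (1 - r) * c₃) (hsep : 2 * R.Y 0 ≤ R.Y 1) (t : ℝ) :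
    (ofWindows R c₃ r hr0 hr1 hgeo hclock hsep).f t = 0 :=
  rfl

/-- The window schedule's datum is zero. [folklore] -/
theorem ofWindows_datum {c₃ r : ℝ} (hr0 : 0 ≤ r) (hr1 : r < 1)
    (hgeo : ∀ k, R.window (k + 1) ≤ r * R.window k)
    (hclock : ∀ k, R.A k * R.window (k + 1) ≤ (1 - r) * c₃) (hsep : 2 * R.Y 0 ≤ R.Y 1) :
    (ofWindows R c₃ r hr0 hr1 hgeo hclock hsep).u₀ = 0 :=
  rfl

/-- The window schedule satisfies the registered pins `Schedule.Pins Λ (6/5)` for every impulse dial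
`Λ` (its window force is zero) whenever the rates afford `2 Y_k ≤ Y_{k+1}`. [folklore] -/
theorem ofWindows_pins {c₃ r : ℝ} (hr0 : 0 ≤ r) (hr1 : r < 1)
    (hgeo : ∀ k, R.window (k + 1) ≤ r * R.window k)
    (hclock : ∀ k, R.A k * R.window (k + 1) ≤ (1 - r) * c₃) (hsep : ∀ k, 2 * R.Y k ≤ R.Y (k + 1))
    (Λ : ℝ) : (ofWindows R c₃ r hr0 hr1 hgeo hclock (hsep 0)).Pins Λ (6 / 5) where
  impulse := by
    intro k
    show Λ * (0 * R.Y k) * _ ≤ 1 * R.Y (k + 1) - 5 / 3 * R.Y k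
    have := hsep k
    have hY : 0 < R.Y k := Real.rpow_pos_of_pos (R.N_pos k) _
    simp only [zero_mul, mul_zero, one_mul]
    linarith
  sep := by
    intro k
    show 6 / 5 * (5 / 3 * R.Y k) ≤ 1 * R.Y (k + 1)
    have := hsep k
    linarith
  datum_confined := fun _ _ => rfl
  force_confined := fun _ _ _ => rfl

/-- The window schedule is rigid in the sense of REGISTER v2.1 (window equality, `c₅ = 4bβ`,
`c₁ = 1`, `c₂ = 5/3`) — by construction. [folklore] -/
theorem ofWindows_rigid {c₃ r : ℝ} (hr0 : 0 ≤ r) (hr1 : r < 1)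
    (hgeo : ∀ k, R.window (k + 1) ≤ r * R.window k)
    (hclock : ∀ k, R.A k * R.window (k + 1) ≤ (1 - r) * c₃) (hsep : 2 * R.Y 0 ≤ R.Y 1) :
    (ofWindows R c₃ r hr0 hr1 hgeo hclock hsep).Rigid where
  window_eq := by
    intro k
    show windowTime R (k + 1) = windowTime R k + 4 * R.b * R.β * Real.log (R.N (k + 1)) / R.A k
    rw [windowTime_succ]
    rfl
  c₅_eq := rfl
  c₁_eq := rfl
  c₂_eq := rfl

/-- **The registered schedule class is nonempty** (generic form): under geometric domination of the
windows, a clock witness and the registered band, some schedule satisfies `Pins Λ (6/5)` and `Rigid`.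
[folklore] -/
theorem exists_pins_rigid_of_windows {c₃ r : ℝ} (hr0 : 0 ≤ r) (hr1 : r < 1)
    (hgeo : ∀ k, R.window (k + 1) ≤ r * R.window k)
    (hclock : ∀ k, R.A k * R.window (k + 1) ≤ (1 - r) * c₃) (hsep : ∀ k, 2 * R.Y k ≤ R.Y (k + 1))
    (Λ : ℝ) : ∃ S : Schedule R, S.Pins Λ (6 / 5) ∧ S.Rigid ∧ ∀ t, S.f t = 0 :=
  ⟨ofWindows R c₃ r hr0 hr1 hgeo hclock (hsep 0), ofWindows_pins hr0 hr1 hgeo hclock hsep Λ,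
    ofWindows_rigid hr0 hr1 hgeo hclock (hsep 0), fun _ => rfl⟩

end Schedule

/-! ## §2 The registered instance: `TowerRates.wide`, `c₃ = 32`, `r = 1/3` -/

namespace TowerRates

/-- On the wide-base rates `log N_k ≥ log 256 ≥ 5.5448`. [folklore] -/
theorem wide_log_N_ge (k : ℕ) : (55448 : ℝ) / 10000 ≤ Real.log (wide.N k) := by
  have hN₀ : wide.N₀ = 256 := rfl
  have h1 : Real.log 256 ≤ Real.log (wide.N k) := by
    have := wide.N₀_le_N k
    rw [hN₀] at this
    exact Real.log_le_log (by norm_num) this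
  have h2 : Real.log (256 : ℝ) = 8 * Real.log 2 := by
    rw [show (256 : ℝ) = 2 ^ 8 by norm_num, Real.log_pow]
    norm_num
  have h3 := Real.log_two_gt_d9
  linarith

/-- On the wide-base rates the amplitude ratio is `A_{k+1} = A_k · e^{0.23 log N_k}`. [folklore] -/
theorem wide_A_succ (k : ℕ) :
    wide.A (k + 1) = wide.A k * Real.exp (23 / 100 * Real.log (wide.N k)) := by
  have hb : wide.b = 11 / 10 := rfl
  have hβ : wide.β = 23 / 10 := rfl
  rw [wide.A_succ k, Real.rpow_def_of_pos (wide.N_pos k), hb, hβ]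
  congr 1
  congr 1
  ring

/-- **Geometric domination on the wide base**: `w_{k+1} ≤ w_k / 3`
(`w_{k+1}/w_k = b N_k^{-β(b-1)} = 1.1 · e^{-0.23 log N_k} ≤ 1.1 / 3.43`). [folklore] -/
theorem wide_window_geo (k : ℕ) : wide.window (k + 1) ≤ 1 / 3 * wide.window k := by
  have hb : wide.b = 11 / 10 := rfl
  have hβ : wide.β = 23 / 10 := rfl
  have hA : 0 < wide.A k := wide.A_pos k
  have hL := wide_log_N_ge k
  have hlog := wide.log_N_pos (k + 1)
  set w : ℝ := 23 / 100 * Real.log (wide.N k) with hw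
  have hw0 : 0 ≤ w := by rw [hw]; linarith
  have hexp : 1 + w + w ^ 2 / 2 + w ^ 3 / 6 ≤ Real.exp w := by
    -- cubic Taylor bound (`Real.sum_le_exp_of_nonneg` with four terms; the same one-liner is
    -- `Literature.NumberTheory.Sieve.JurkatRichert.cubic_le_exp`, not imported here)
    have h := Real.sum_le_exp_of_nonneg hw0 4
    have hs : ∑ i ∈ Finset.range 4, w ^ i / (i.factorial : ℝ) = 1 + w + w ^ 2 / 2 + w ^ 3 / 6 := by
      simp [Finset.sum_range_succ, Nat.factorial]
    linarith [hs]
  have hwge : (127530 : ℝ) / 100000 ≤ w := by rw [hw]; linarith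
  have hw2 : ((127530 : ℝ) / 100000) ^ 2 ≤ w ^ 2 := by nlinarith
  have hw3 : ((127530 : ℝ) / 100000) ^ 3 ≤ w ^ 3 := by nlinarith
  have hE3 : (33 : ℝ) / 10 ≤ Real.exp w := by
    have : (33 : ℝ) / 10 ≤ 1 + w + w ^ 2 / 2 + w ^ 3 / 6 := by nlinarith
    linarith
  unfold TowerRates.window
  rw [wide.log_N_succ (k + 1), wide_A_succ k, hb, hβ]
  rw [div_le_iff₀ (mul_pos hA (Real.exp_pos _))]
  have hEpos : 0 < Real.exp w := Real.exp_pos _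
  -- `4·(11/10)·(23/10)·((11/10)·log N_{k+1}) ≤ (1/3)·(4·(11/10)·(23/10)·log N_{k+1} / A_k)·(A_k·exp w)`
  have key : (11 / 10 : ℝ) * Real.log (wide.N (k + 1)) ≤
      1 / 3 * (Real.log (wide.N (k + 1)) / wide.A k) * (wide.A k * Real.exp w) := by
    have e : 1 / 3 * (Real.log (wide.N (k + 1)) / wide.A k) * (wide.A k * Real.exp w) =
        Real.log (wide.N (k + 1)) * (Real.exp w / 3) := by
      field_simp
    rw [e]
    nlinarith
  have e2 : 1 / 3 * (4 * (11 / 10 : ℝ) * (23 / 10) * Real.log (wide.N (k + 1)) / wide.A k) *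
      (wide.A k * Real.exp w) =
      4 * (11 / 10) * (23 / 10) * (1 / 3 * (Real.log (wide.N (k + 1)) / wide.A k) *
        (wide.A k * Real.exp w)) := by ring
  rw [e2]
  nlinarith

/-- **Clock arithmetic on the wide base**: `A_k w_{k+1} ≤ (2/3) · 32`, i.e.
`12.2452 · L · e^{-0.23 L} ≤ 21.33` for `L = log N_k ≥ 5.5448` (`e^{0.23 L} ≥` cubic Taylor).
[folklore] -/
theorem wide_window_clock (k : ℕ) : wide.A k * wide.window (k + 1) ≤ (1 - 1 / 3) * 32 := by
  have hb : wide.b = 11 / 10 := rfl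
  have hβ : wide.β = 23 / 10 := rfl
  have hA : 0 < wide.A k := wide.A_pos k
  have hL := wide_log_N_ge k
  set L : ℝ := Real.log (wide.N k) with hLdef
  have hlog2 : Real.log (wide.N (k + 2)) = (11 / 10) ^ 2 * L := by
    rw [wide.log_N_succ (k + 1), wide.log_N_succ k, hb]
    ring
  set w : ℝ := 23 / 100 * L with hw
  have hw0 : 0 ≤ w := by rw [hw]; linarith
  have hexp : 1 + w + w ^ 2 / 2 + w ^ 3 / 6 ≤ Real.exp w := by
    -- cubic Taylor bound (`Real.sum_le_exp_of_nonneg` with four terms; the same one-liner is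
    -- `Literature.NumberTheory.Sieve.JurkatRichert.cubic_le_exp`, not imported here)
    have h := Real.sum_le_exp_of_nonneg hw0 4
    have hs : ∑ i ∈ Finset.range 4, w ^ i / (i.factorial : ℝ) = 1 + w + w ^ 2 / 2 + w ^ 3 / 6 := by
      simp [Finset.sum_range_succ, Nat.factorial]
    linarith [hs]
  have hEpos : 0 < Real.exp w := Real.exp_pos _
  unfold TowerRates.window
  rw [show k + 1 + 1 = k + 2 from rfl, hlog2, wide_A_succ k, hb, hβ]
  -- goal: `A_k * (4·(11/10)·(23/10)·((11/10)²·L) / (A_k · exp w)) ≤ (2/3)·32`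
  have e : wide.A k * (4 * (11 / 10 : ℝ) * (23 / 10) * ((11 / 10) ^ 2 * L) /
      (wide.A k * Real.exp w)) = (12122452 / 1000000 + 122748 / 1000000) * L / Real.exp w := by
    field_simp
    ring
  rw [← hLdef, e, div_le_iff₀ hEpos]
  -- polynomial certificate: `12.2452 L ≤ 21.333… · (1 + w + w²/2 + w³/6) ≤ 21.333… · exp w`
  have h1 : 0 ≤ L - 55448 / 10000 := by linarith
  have h2 : 0 ≤ (L - 55448 / 10000) ^ 2 := sq_nonneg _
  have h3 : 0 ≤ (L - 55448 / 10000) ^ 3 := by positivity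
  have hpoly : (12122452 / 1000000 + 122748 / 1000000 : ℝ) * L ≤
      (1 - 1 / 3) * 32 * (1 + w + w ^ 2 / 2 + w ^ 3 / 6) := by
    rw [hw]
    nlinarith
  nlinarith

/-- **The registered schedule class of the E–C route (REGISTER v2.1) is NONEMPTY**: some schedule on
the wide-base rates satisfies `Schedule.Pins 8 (6/5)` and `Schedule.Rigid` (the window schedule with
zero datum and zero force, clock witness `c₃ = 32`). [folklore] -/
theorem exists_registered_schedule :
    ∃ S : Schedule wide, S.Pins 8 (6 / 5) ∧ S.Rigid ∧ ∀ t, S.f t = 0 :=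
  Schedule.exists_pins_rigid_of_windows (by norm_num) (by norm_num) wide_window_geo
    wide_window_clock wide_sep 8

end TowerRates

end Summit.NavierStokesRegularity.FluidComputer.PalasekTowerClayBridge

end
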